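/-
HONEST FRAMING (page 1). Ladder R1–R4 with certified numbers; no claim on `H/H₀`.
Bounds for model classes (nearest-neighbour Hubbard model on the torus `(ℤ/L)²`), no materials claim.
-/
import Summits.HubbardSuperconductivity.HubbardLadder.Bounds.DirectionalKineticPositivity
import Summits.HubbardSuperconductivity.HubbardLadder.Bounds.ThermalAttractiveSpinCeilingCanonical
import HarnessLib

/-!
# Hubbard ladder — Bounds: sharp `q`-dependent canonical structure-factor ceilings (REQUEST #179.2)

HONEST FRAMING. Ladder R1–R4 with certified numbers; no claim on `H/H₀`. Bounds for model classes
(the nearest-neighbour Hubbard Hamiltonian `H(1,U)` on the torus `(ℤ/L)²`), no materials claim.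
Finite volume, fixed particle numbers, every `T = 1/β > 0`; nothing is claimed at `T = 0` or in the
thermodynamic limit.

THE POINT (`paper/bounds.tex` Prop. 11.5 / Cor. 11.4). Kubo–Kishi's structure-factor ceilings
(KK90 Thm 1 eqs. (3)–(4) for `U < 0`, Thm 2 eq. (5) for `U > 0` at half filling) have the Falk–Bruch
shape `β (A,A) ≤ B ⇒ ⟨A²⟩ ≤ B/β + ½ √(B C)`, `C = ⟨[A,[H,A]]⟩`. For a family of density profiles
`a_i` the double commutators sum to the weighted hopping form `T(W)`, `W(u,v) = Σ_i (a_i(u) - a_i(v))²`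
(block f-sum identities of `HubbardCanonicalSusceptibilityBounds`). When `W` is DIRECTION-HOMOGENEOUS,
`W = Σ_j ε_j 1_{dir j}` on bonds (plane waves `a = (cos q·x, sin q·x)`: `ε_j = 2 - 2 cos q_j
= 4 sin²(q_j/2)`; staggered profile: `ε ≡ 4`), the directional kinetic positivity of #179.1
(`re_gibbsState_hoppingForm_dirWeighted_toBlock_le`, proved below from
`re_gibbsState_dirHopping_toBlock_nonneg`) gives, in ANY `(N↑,N↓)` sector `p` and WITHOUT the
translation/rotation symmetry used by Kubo–Kishi,

  `C ≤ ε_max · ⟨-H(1,0)|_p⟩_{β,p} ≤ ε_max · k_p`,   `ε_max = max_j ε_j`,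

with `k_p` any of the cell's canonical kinetic ceilings (#106 sharp / #103 density for `U < 0`;
#158 Mott window for `U > 0`). Hence (theorems `…_le_of_kinetic_dir`, nodes
`ThermalAttractiveSDWCeilingCanonicalDir`, `ThermalMottCDWCeilingCanonicalDir`):

  `Σ_i Re⟨(M_{a_i}|_p)²⟩_{β,p} ≤ B T/|U| + ½ √((B/|U|) ε_max k_p)`,  `B = Σ_i Σ_x a_i(x)²`,

and the same with `N_{a_i}`, `U` for the repulsive half-filled sector. Per site, for a plane wave
(`B = L²`): `4 S^{zz}_{β,p}(q) ≤ T/|U| + |sin(q_max/2)| √(k_p/(L²|U|))` — Kubo–Kishi-sharp on the zone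
diagonal `q = (θ,θ)` (there `ε_max` = mean `ε`), within a factor `≤ 2` under the root elsewhere
(`ε_max` against KK's direction average, which needs the rotation symmetry not available in the tree),
equal to rows T9ᵃ/T9ᶜ (#174/#173) at `q = Q = (π,π)`, and COMPLEMENTARY to the band-bound row T9ᵇ
(#177: `C ≤ 32 m` per unit profile, no kinetic input): the nodes below are the sharper ones iff
`ε_max · k_p ≤ 32 m` (small `|q|`, strong coupling, low `T`), T9ᵇ wins at weak coupling / low density /
high `T`; in the general-kinetic form (`…_of_kinetic_dir`, any certified `k ≥ ⟨-T(1)|_p⟩`) the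
directional constant is `ε_max · k`. Both rows are unconditional.

References: KuboKishi1990 (Thms 1–2, Remarks 1–3); LiebPRL1989 (Thms 1–2); DLS1978 §2, Lemma 4.1,
Thm 3.1; KomaTasakiPRL1992 eqs. (5)–(8); this cell #179.1, #174, #173, #158, #106.
Presearch (corpus fts+vec AND galaxy, 2026-08-21): nearest KK90 p.122 (symmetry step) — no sector /
symmetry-free version found. Grade: VARIANT.
-/

namespace Summit.HubbardSuperconductivity.HubbardLadder.Bounds

open Matrix Finset Real
open Literature.MathematicalPhysics.QuantumLattice
open Literature.MathematicalPhysics.QuantumFieldTheory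
open Literature.Probability.LatticeModels
open scoped ComplexOrder ComplexConjugate

section Torus

variable {L : ℕ} [NeZero L]


/-! ### Direction-weighted hopping forms are dominated by the kinetic energy -/

omit [NeZero L] in
/-- **Cor. of Prop. 11.5 (direction-weighted kinetic forms are dominated by the total kinetic energy).**
For direction weights `ε_j ≤ ε_max` (`j = 0, 1`), any real `t, U, μ`, `β > 0`, any non-empty block `p`:
`t · Re⟨T(Σ_j ε_j 1_{dir j})|_p⟩_{β,H|_p} ≤ ε_max · t · Re⟨T(1)|_p⟩_{β,H|_p}`. -/
theorem re_gibbsState_hoppingForm_dirWeighted_toBlock_le (t U μ : ℝ) {β : ℝ}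
    (hβ : 0 < β) (p : Finset (Orb (FermionTorus 2 L)) → Prop) [DecidablePred p] [Nonempty {s // p s}]
    (ε : Fin 2 → ℝ) {εmax : ℝ} (hε : ∀ j, ε j ≤ εmax) :
    t * (gibbsState β ((hamiltonianWith (fermionTorusGraph 2 L) t U μ).toBlock p p)
      ((hoppingForm (fermionTorusGraph 2 L) fun u v => ∑ j, ε j * dirWeight j u v).toBlock p p)).re ≤
      εmax * (t * (gibbsState β ((hamiltonianWith (fermionTorusGraph 2 L) t U μ).toBlock p p)
        ((hoppingForm (fermionTorusGraph 2 L) fun _ _ => (1 : ℝ)).toBlock p p)).re) := by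
  set g : Fin 2 → ℝ := fun j => t * (gibbsState β ((hamiltonianWith (fermionTorusGraph 2 L) t U μ).toBlock p p)
      ((hoppingForm (fermionTorusGraph 2 L) (dirWeight j)).toBlock p p)).re with hg
  have hg0 : ∀ j, 0 ≤ g j := fun j => re_gibbsState_dirHopping_toBlock_nonneg j t U μ hβ p
  have hsmul : ∀ (c : ℝ) (w : FermionTorus 2 L → FermionTorus 2 L → ℝ),
      hoppingForm (fermionTorusGraph 2 L) (fun u v => c * w u v) = (c : ℂ) • hoppingForm (fermionTorusGraph 2 L) w := by
    intro c w
    rw [hoppingForm_eq, hoppingForm_eq, Finset.smul_sum]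
    refine Finset.sum_congr rfl fun x _ => ?_
    rw [Finset.smul_sum]
    refine Finset.sum_congr rfl fun y _ => ?_
    rw [Finset.smul_sum]
    refine Finset.sum_congr rfl fun σ _ => ?_
    by_cases hxy : (fermionTorusGraph 2 L).Adj x y
    · rw [if_pos hxy, if_pos hxy, smul_smul, Complex.ofReal_mul]
    · rw [if_neg hxy, if_neg hxy, smul_zero]
  have hlinB : ∀ X Y : Matrix (Finset (Orb (FermionTorus 2 L))) (Finset (Orb (FermionTorus 2 L))) ℂ,
      (X + Y).toBlock p p = X.toBlock p p + Y.toBlock p p := fun _ _ => rfl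
  have hsmB : ∀ (c : ℂ) (X : Matrix (Finset (Orb (FermionTorus 2 L))) (Finset (Orb (FermionTorus 2 L))) ℂ),
      (c • X).toBlock p p = c • X.toBlock p p := fun _ _ => rfl
  have hsum : (hoppingForm (fermionTorusGraph 2 L) fun u v => ∑ j, ε j * dirWeight j u v) =
      ((ε 0 : ℝ) : ℂ) • hoppingForm (fermionTorusGraph 2 L) (dirWeight 0) + ((ε 1 : ℝ) : ℂ) • hoppingForm (fermionTorusGraph 2 L) (dirWeight 1) := by
    rw [← hsmul, ← hsmul, hoppingForm_add]
    congr 1; funext u v; rw [Fin.sum_univ_two]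
  have hL : t * (gibbsState β ((hamiltonianWith (fermionTorusGraph 2 L) t U μ).toBlock p p)
      ((hoppingForm (fermionTorusGraph 2 L) fun u v => ∑ j, ε j * dirWeight j u v).toBlock p p)).re = ε 0 * g 0 + ε 1 * g 1 := by
    rw [hsum, hlinB, hsmB, hsmB, map_add, map_smul, map_smul, Complex.add_re, smul_eq_mul, smul_eq_mul,
      Complex.re_ofReal_mul, Complex.re_ofReal_mul, hg]
    ring
  have hR : t * (gibbsState β ((hamiltonianWith (fermionTorusGraph 2 L) t U μ).toBlock p p)
      ((hoppingForm (fermionTorusGraph 2 L) fun _ _ => (1 : ℝ)).toBlock p p)).re = g 0 + g 1 := by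
    rw [hoppingForm_one_eq_sum_dirWeight, hlinB, map_add, Complex.add_re, hg]
    ring
  rw [hL, hR, mul_add]
  exact add_le_add (mul_le_mul_of_nonneg_right (hε 0) (hg0 0)) (mul_le_mul_of_nonneg_right (hε 1) (hg0 1))

omit [NeZero L] in
/-- Additivity of `w ↦ ⟨T(w)|_p⟩` over a finite family of bond weights. -/
theorem sum_gibbsState_hoppingForm_toBlock
    (H : Matrix (Finset (Orb (FermionTorus 2 L))) (Finset (Orb (FermionTorus 2 L))) ℂ) (β : ℝ)
    (p : Finset (Orb (FermionTorus 2 L)) → Prop) [DecidablePred p] {ι : Type*} (s : Finset ι)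
    (w : ι → FermionTorus 2 L → FermionTorus 2 L → ℝ) :
    ∑ i ∈ s, gibbsState β (H.toBlock p p) ((hoppingForm (fermionTorusGraph 2 L) (w i)).toBlock p p) =
      gibbsState β (H.toBlock p p) ((hoppingForm (fermionTorusGraph 2 L) fun u v => ∑ i ∈ s, w i u v).toBlock p p) := by
  classical
  refine Finset.induction_on s ?_ (fun i s hi ih => ?_)
  · simp only [Finset.sum_empty]
    rw [hoppingForm_const (fermionTorusGraph 2 L) 0, Complex.ofReal_zero, zero_smul]
    exact (map_zero _).symm
  · rw [Finset.sum_insert hi, ih, ← map_add,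
      show (hoppingForm (fermionTorusGraph 2 L) (w i)).toBlock p p + (hoppingForm (fermionTorusGraph 2 L) fun u v => ∑ i ∈ s, w i u v).toBlock p p =
        (hoppingForm (fermionTorusGraph 2 L) (w i) + hoppingForm (fermionTorusGraph 2 L) fun u v => ∑ i ∈ s, w i u v).toBlock p p from rfl,
      hoppingForm_add]
    simp only [Finset.sum_insert hi]

/-! ### Attractive `U < 0`: every `(m ↑, m ↓)` sector, every direction-homogeneous family -/

omit [NeZero L] in
/-- **Prop. 11.5 ⇒ sharp Falk–Bruch in a `(m ↑, m ↓)` sector of the attractive torus** (`U < 0`,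
`β > 0`, `p` any presentation of the sector, non-empty): for profiles `a_i` with
`Σ_i (a_i(u) - a_i(v))² = Σ_j ε_j 1_{dir j}(u,v)` on bonds, `ε_j ≤ ε_max`, `0 ≤ ε_max`, and any bound
`⟨-H(1,0)|_p⟩_{β,p} ≤ k` on the sector kinetic energy:
`Σ_i Re⟨(M_{a_i}|_p)²⟩_{β,p} ≤ B/(β|U|) + ½ √((B/|U|) ε_max k)`, `B = Σ_i Σ_x a_i(x)²`. -/
theorem re_gibbsState_sum_spinDensityField_sq_toBlock_le_of_kinetic_dir {U β k : ℝ} (hU : U < 0)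
    (hβ : 0 < β) {m : ℕ} (p : Finset (Orb (FermionTorus 2 L)) → Prop) [DecidablePred p]
    [Nonempty {s // p s}] (hp : ∀ s, p s ↔ (upPart s).card = m ∧ (downPart s).card = m)
    {ι : Type*} [Fintype ι] (a : ι → FermionTorus 2 L → ℝ) (ε : Fin 2 → ℝ) {εmax : ℝ}
    (hε : ∀ j, ε j ≤ εmax) (hεmax : 0 ≤ εmax)
    (ha : ∀ u v, (fermionTorusGraph 2 L).Adj u v → ∑ i, (a i u - a i v) ^ 2 = ∑ j, ε j * dirWeight j u v)
    (hkin : -(gibbsState β ((hubbardTorusTT' L 1 0 U).toBlock p p)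
        ((hubbardTorusTT' L 1 0 0).toBlock p p)).re ≤ k) :
    ∑ i, (gibbsState β ((hubbardTorusTT' L 1 0 U).toBlock p p)
        ((spinDensityField (a i)).toBlock p p * (spinDensityField (a i)).toBlock p p)).re ≤
      (∑ i, ∑ x, a i x ^ 2) / (-U) / β +
        1 / 2 * Real.sqrt ((∑ i, ∑ x, a i x ^ 2) / (-U) * (εmax * k)) := by
  have hU0 : 0 < -U := neg_pos.2 hU
  -- Kubo–Kishi's Falk–Bruch form in the sector, the double commutators as weighted hopping forms
  have h := hubbard_attractive_sector_falkBruch_le (fermionTorusGraph 2 L) (t := 1) (μ := 0) hU hβ p hp a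
  simp only [spinDensityField_doubleComm_toBlock_eq (fermionTorusGraph 2 L) _ 1 U 0 p hp, Complex.ofReal_one, one_smul,
    abs_of_neg hU] at h
  have hHT : hubbardTorusTT' L 1 0 U = hamiltonianWith (fermionTorusGraph 2 L) 1 U 0 := hubbardTorusTT'_eq_hamiltonianWith U
  set H := hamiltonianWith (fermionTorusGraph 2 L) 1 U 0 with hH
  -- re-elaborate `h` with this file's instances (`convert` closes the `DecidableEq` mismatch)
  have h' : ∑ i, (gibbsState β (H.toBlock p p)
        ((spinDensityField (a i)).toBlock p p * (spinDensityField (a i)).toBlock p p)).re ≤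
      (∑ i, ∑ x, a i x ^ 2) / (-U) / β +
        1 / 2 * Real.sqrt ((∑ i, ∑ x, a i x ^ 2) / (-U) *
          ∑ i, (gibbsState β (H.toBlock p p)
            ((hoppingForm (fermionTorusGraph 2 L) fun x y => (a i x - a i y) ^ 2).toBlock p p)).re) := by
    convert h using 14
  -- `Σ_i T((a_i(x) - a_i(y))²) = T(Σ_j ε_j 1_{dir j})`
  have hsum : ∑ i, (gibbsState β (H.toBlock p p)
      ((hoppingForm (fermionTorusGraph 2 L) fun x y => (a i x - a i y) ^ 2).toBlock p p)).re =
      (gibbsState β (H.toBlock p p)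
        ((hoppingForm (fermionTorusGraph 2 L) fun u v => ∑ j, ε j * dirWeight j u v).toBlock p p)).re := by
    rw [← Complex.re_sum, sum_gibbsState_hoppingForm_toBlock, hoppingForm_congr_adj (fermionTorusGraph 2 L) ha]
  -- Prop. 11.5: `Re⟨T(Σ_j ε_j 1_{dir j})|_p⟩ ≤ ε_max Re⟨T(1)|_p⟩ = ε_max ⟨-H(1,0)|_p⟩ ≤ ε_max k`
  have hw := re_gibbsState_hoppingForm_dirWeighted_toBlock_le (L := L) 1 U 0 hβ p ε hε
  rw [one_mul, one_mul] at hw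
  have hT : (gibbsState β (H.toBlock p p) ((hoppingForm (fermionTorusGraph 2 L) fun _ _ => (1 : ℝ)).toBlock p p)).re =
      -(gibbsState β ((hubbardTorusTT' L 1 0 U).toBlock p p) ((hubbardTorusTT' L 1 0 0).toBlock p p)).re := by
    rw [hoppingForm_one_eq_neg_hubbardTorusTT', hHT,
      show (-hubbardTorusTT' L 1 0 0).toBlock p p = -((hubbardTorusTT' L 1 0 0).toBlock p p) from rfl,
      map_neg, Complex.neg_re]
  rw [hHT]
  refine h'.trans (fbRhs_mono_doubleComm
    (div_nonneg (sum_nonneg fun i _ => sum_nonneg fun x _ => sq_nonneg _) hU0.le) ?_)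
  rw [hsum]
  refine hw.trans ?_
  rw [hT]
  exact mul_le_mul_of_nonneg_left hkin hεmax

/-- **Cor. 11.4 (attractive), sharp kinetic slot**: as above with `k = 32 L²/|U| + (log N_p)/β`
(Thm 8♯(v), `neg_re_gibbsState_hopping_le_attractive_sharp`, #106; `L ≥ 4` even, `m ≤ L²`). -/
theorem re_gibbsState_sum_spinDensityField_sq_toBlock_le_attractive_dir (hLe : Even L) (hL : 3 ≤ L)
    {U β : ℝ} (hU : U < 0) (hβ : 0 < β) {m : ℕ} (hm : m ≤ L ^ 2)
    (p : Finset (Orb (FermionTorus 2 L)) → Prop) [DecidablePred p] [Nonempty {s // p s}]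
    (hp : ∀ s, p s ↔ (upPart s).card = m ∧ (downPart s).card = m)
    {ι : Type*} [Fintype ι] (a : ι → FermionTorus 2 L → ℝ) (ε : Fin 2 → ℝ) {εmax : ℝ}
    (hε : ∀ j, ε j ≤ εmax) (hεmax : 0 ≤ εmax)
    (ha : ∀ u v, (fermionTorusGraph 2 L).Adj u v → ∑ i, (a i u - a i v) ^ 2 = ∑ j, ε j * dirWeight j u v) :
    ∑ i, (gibbsState β ((hubbardTorusTT' L 1 0 U).toBlock p p)
        ((spinDensityField (a i)).toBlock p p * (spinDensityField (a i)).toBlock p p)).re ≤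
      (∑ i, ∑ x, a i x ^ 2) / (-U) / β +
        1 / 2 * Real.sqrt ((∑ i, ∑ x, a i x ^ 2) / (-U) *
          (εmax * (32 * (L : ℝ) ^ 2 / (-U) + Real.log (Fintype.card {s // p s}) / β))) := by
  have hpN : ∀ s, p s → s.card = 2 * m := fun s hs => by
    rw [card_eq_upPart_add_downPart, ((hp s).1 hs).1, ((hp s).1 hs).2]; ring
  have hpair : ∀ A : Finset (FermionTorus 2 L), A.card = m → p (pairSet A A) := fun A hA =>
    (hp _).2 ((spinZeroSector_iff_upPart_downPart _ m).1 (pairSet_mem_spinZeroSector A hA))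
  exact re_gibbsState_sum_spinDensityField_sq_toBlock_le_of_kinetic_dir hU hβ p hp a ε hε hεmax ha
    (neg_re_gibbsState_hopping_le_attractive_sharp hLe hL hU hβ hm p hpN hpair)

/-! ### Repulsive `U > 0`, half filling: the `(L²/2 ↑, L²/2 ↓)` sector -/

omit [NeZero L] in
/-- **Prop. 11.5 ⇒ sharp Falk–Bruch in the half-filled `(L²/2 ↑, L²/2 ↓)` sector of the repulsive
torus** (`L` even, `U > 0`, `β > 0`): for profiles `a_i` with `Σ_i (a_i(u) - a_i(v))² = Σ_j ε_j 1_{dir j}`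
on bonds, `ε_j ≤ ε_max`, `0 ≤ ε_max`, and any bound `⟨-H(1,0)|_p⟩_{β,p} ≤ k`:
`Σ_i Re⟨(N_{a_i}|_p)²⟩_{β,p} ≤ B/(βU) + ½ √((B/U) ε_max k)`, `B = Σ_i Σ_x a_i(x)²`. -/
theorem re_gibbsState_sum_chargeDensityField_sq_toBlock_le_of_kinetic_dir (hLe : Even L) {U β k : ℝ}
    (hU : 0 < U) (hβ : 0 < β) (p : Finset (Orb (FermionTorus 2 L)) → Prop) [DecidablePred p]
    [Nonempty {s // p s}] (hp : ∀ s, p s ↔ (upPart s).card = L ^ 2 / 2 ∧ (downPart s).card = L ^ 2 / 2)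
    {ι : Type*} [Fintype ι] (a : ι → FermionTorus 2 L → ℝ) (ε : Fin 2 → ℝ) {εmax : ℝ}
    (hε : ∀ j, ε j ≤ εmax) (hεmax : 0 ≤ εmax)
    (ha : ∀ u v, (fermionTorusGraph 2 L).Adj u v → ∑ i, (a i u - a i v) ^ 2 = ∑ j, ε j * dirWeight j u v)
    (hkin : -(gibbsState β ((hubbardTorusTT' L 1 0 U).toBlock p p)
        ((hubbardTorusTT' L 1 0 0).toBlock p p)).re ≤ k) :
    ∑ i, (gibbsState β ((hubbardTorusTT' L 1 0 U).toBlock p p)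
        ((chargeDensityField (a i)).toBlock p p * (chargeDensityField (a i)).toBlock p p)).re ≤
      (∑ i, ∑ x, a i x ^ 2) / U / β +
        1 / 2 * Real.sqrt ((∑ i, ∑ x, a i x ^ 2) / U * (εmax * k)) := by
  have hcard : Fintype.card (FermionTorus 2 L) = L ^ 2 := by simp [FermionTorus]
  have hL2e : 2 * (L ^ 2 / 2) = L ^ 2 :=
    Nat.two_mul_div_two_of_even (Nat.even_pow.2 ⟨hLe, two_ne_zero⟩)
  have hkl : L ^ 2 / 2 + L ^ 2 / 2 = Fintype.card (FermionTorus 2 L) := by rw [hcard]; omega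
  have hst : ∀ x y : FermionTorus 2 L, (fermionTorusGraph 2 L).Adj x y →
      torusStagger (d := 2) (L := L) x = -torusStagger y :=
    fun _ _ h => torusStagger_eq_neg_of_adj_holds hLe h
  -- Kubo–Kishi's Falk–Bruch form in the sector, the double commutators as weighted hopping forms
  have h := hubbard_repulsive_halfFilledSector_falkBruch_le (fermionTorusGraph 2 L) _ hst (t := 1) hU hβ hkl p hp a
  simp only [chargeDensityField_doubleComm_toBlock_eq (fermionTorusGraph 2 L) _ 1 U p hp, Complex.ofReal_one, one_smul] at h
  have hHT : hubbardTorusTT' L 1 0 U = hamiltonian (fermionTorusGraph 2 L) 1 U := hubbardTorusTT'_one_zero_eq U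
  set H := hamiltonian (fermionTorusGraph 2 L) 1 U with hH
  have h' : ∑ i, (gibbsState β (H.toBlock p p)
        ((chargeDensityField (a i)).toBlock p p * (chargeDensityField (a i)).toBlock p p)).re ≤
      (∑ i, ∑ x, a i x ^ 2) / U / β +
        1 / 2 * Real.sqrt ((∑ i, ∑ x, a i x ^ 2) / U *
          ∑ i, (gibbsState β (H.toBlock p p)
            ((hoppingForm (fermionTorusGraph 2 L) fun x y => (a i x - a i y) ^ 2).toBlock p p)).re) := by
    convert h using 14
  have hsum : ∑ i, (gibbsState β (H.toBlock p p)
      ((hoppingForm (fermionTorusGraph 2 L) fun x y => (a i x - a i y) ^ 2).toBlock p p)).re =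
      (gibbsState β (H.toBlock p p)
        ((hoppingForm (fermionTorusGraph 2 L) fun u v => ∑ j, ε j * dirWeight j u v).toBlock p p)).re := by
    rw [← Complex.re_sum, sum_gibbsState_hoppingForm_toBlock, hoppingForm_congr_adj (fermionTorusGraph 2 L) ha]
  have hw := re_gibbsState_hoppingForm_dirWeighted_toBlock_le (L := L) 1 U 0 hβ p ε hε
  rw [one_mul, one_mul, hamiltonianWith_zero] at hw
  have hT : (gibbsState β (H.toBlock p p) ((hoppingForm (fermionTorusGraph 2 L) fun _ _ => (1 : ℝ)).toBlock p p)).re =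
      -(gibbsState β ((hubbardTorusTT' L 1 0 U).toBlock p p) ((hubbardTorusTT' L 1 0 0).toBlock p p)).re := by
    rw [hoppingForm_one_eq_neg_hubbardTorusTT', hHT,
      show (-hubbardTorusTT' L 1 0 0).toBlock p p = -((hubbardTorusTT' L 1 0 0).toBlock p p) from rfl,
      map_neg, Complex.neg_re]
  rw [hHT]
  refine h'.trans (fbRhs_mono_doubleComm
    (div_nonneg (sum_nonneg fun i _ => sum_nonneg fun x _ => sq_nonneg _) hU.le) ?_)
  rw [hsum]
  refine hw.trans ?_
  rw [hT]
  exact mul_le_mul_of_nonneg_left hkin hεmax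

/-- **Cor. 11.4 (repulsive), Mott-window kinetic slot**: as above with
`k = L² (U₁ sdwClosed U Δ - U lmClosed U₁)/(U - U₁) + (U₁/(U - U₁)) (log N_p)/β`
(`neg_re_gibbsState_hopping_le_mott_sharp`, #158; `L ≥ 4` even, `0 ≤ U₁ < U`, `Δ ≠ 0`). -/
theorem re_gibbsState_sum_chargeDensityField_sq_toBlock_le_mott_dir (hLe : Even L) (hL : 3 ≤ L)
    {U U₁ Δ β : ℝ} (hU₁ : 0 ≤ U₁) (hU : U₁ < U) (hΔ : Δ ≠ 0) (hβ : 0 < β)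
    (p : Finset (Orb (FermionTorus 2 L)) → Prop) [DecidablePred p] [Nonempty {s // p s}]
    (hp : ∀ s, p s ↔ (upPart s).card = L ^ 2 / 2 ∧ (downPart s).card = L ^ 2 / 2)
    {ι : Type*} [Fintype ι] (a : ι → FermionTorus 2 L → ℝ) (ε : Fin 2 → ℝ) {εmax : ℝ}
    (hε : ∀ j, ε j ≤ εmax) (hεmax : 0 ≤ εmax)
    (ha : ∀ u v, (fermionTorusGraph 2 L).Adj u v → ∑ i, (a i u - a i v) ^ 2 = ∑ j, ε j * dirWeight j u v) :
    ∑ i, (gibbsState β ((hubbardTorusTT' L 1 0 U).toBlock p p)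
        ((chargeDensityField (a i)).toBlock p p * (chargeDensityField (a i)).toBlock p p)).re ≤
      (∑ i, ∑ x, a i x ^ 2) / U / β +
        1 / 2 * Real.sqrt ((∑ i, ∑ x, a i x ^ 2) / U *
          (εmax * ((L : ℝ) ^ 2 * ((U₁ * sdwClosed U Δ - U * lmClosed U₁) / (U - U₁)) +
            U₁ / (U - U₁) * (Real.log (Fintype.card {s // p s}) / β)))) := by
  have hU0 : 0 < U := lt_of_le_of_lt hU₁ hU
  have hL2e : 2 * (L ^ 2 / 2) = L ^ 2 :=
    Nat.two_mul_div_two_of_even (Nat.even_pow.2 ⟨hLe, two_ne_zero⟩)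
  have hpN : ∀ s, p s → s.card = L ^ 2 := fun s hs => by
    rw [card_eq_upPart_add_downPart, ((hp s).1 hs).1, ((hp s).1 hs).2]; omega
  exact re_gibbsState_sum_chargeDensityField_sq_toBlock_le_of_kinetic_dir hLe hU0 hβ p hp a ε hε hεmax ha
    (neg_re_gibbsState_hopping_le_mott_sharp hLe hL hU₁ hU hΔ hβ p hpN fun s hs => (hp s).2 hs)

/-! ### Node forms -/

/-- Node: **Cor. 11.4 — the sharp `q`-dependent SDW ceiling of the attractive torus in the
`(2m, S^z = 0)` sector** (UNCONDITIONAL; the sector and state of #106): for every even `L ≥ 4`,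
`U < 0`, `T > 0`, `m ≤ L²`, every finite family of real profiles `a_i` whose bond energy is
direction-homogeneous, `Σ_i (a_i(u) - a_i(v))² = Σ_j ε_j 1_{dir j}(u,v)`, `0 ≤ ε_j ≤ ε_max`
(plane wave `(cos q·x, sin q·x)`: `ε_j = 4 sin²(q_j/2)`, `B = L²`):
`Σ_i Re⟨(M_{a_i}|_p)²⟩_{β,p} ≤ B T/|U| + ½ √((B/|U|) ε_max (32 L²/|U| + T log N_p))`; per site for a
plane wave: `4 S^{zz}_{β,p}(q) ≤ T/|U| + |sin(q_max/2)| √((32/|U| + T (log N_p)/L²)/|U|)` (`log N_p ≤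
L² log 4`). kind: support (PROVED). Why it might fail: it cannot; KK-sharp on the zone diagonal, a
factor `≤ 2` under the root off it (`ε_max` against KK's direction average). Sources: KuboKishi1990
Thm 1, Remarks 1, 3; LiebPRL1989 Thm 1; DLS1978 Lemma 4.1, Thm 3.1; KomaTasakiPRL1992 eqs. (5)–(8);
this cell (bounds.tex Prop. 11.5, Cor. 11.4; #179.1, #174, #106). -/
@[conjecture] def ThermalAttractiveSDWCeilingCanonicalDir : Prop :=
  ∀ (L : ℕ) [NeZero L], Even L → 3 ≤ L → ∀ (U β : ℝ) (m : ℕ) (ι : Type) [Fintype ι]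
    (a : ι → FermionTorus 2 L → ℝ) (ε : Fin 2 → ℝ) (εmax : ℝ), U < 0 → 0 < β → m ≤ L ^ 2 →
    (∀ j, ε j ≤ εmax) → 0 ≤ εmax →
    (∀ u v, (fermionTorusGraph 2 L).Adj u v → ∑ i, (a i u - a i v) ^ 2 = ∑ j, ε j * dirWeight j u v) →
    let p : Finset (Orb (FermionTorus 2 L)) → Prop := fun s =>
      s.card = 2 * m ∧ 2 * (s.filter fun i => (ofLex i).2 = 0).card = 2 * m
    ∑ i, (gibbsState β ((hubbardTorusTT' L 1 0 U).toBlock p p)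
        ((spinDensityField (a i)).toBlock p p * (spinDensityField (a i)).toBlock p p)).re ≤
      (∑ i, ∑ x, a i x ^ 2) / (-U) / β +
        1 / 2 * Real.sqrt ((∑ i, ∑ x, a i x ^ 2) / (-U) *
          (εmax * (32 * (L : ℝ) ^ 2 / (-U) + Real.log (Fintype.card {s // p s}) / β)))

/-- **`ThermalAttractiveSDWCeilingCanonicalDir` holds.** -/
theorem thermalAttractiveSDWCeilingCanonicalDir_holds : ThermalAttractiveSDWCeilingCanonicalDir := by
  intro L _ hLe hL U β m ι _ a ε εmax hU hβ hm hε hεmax ha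
  dsimp only
  set p : Finset (Orb (FermionTorus 2 L)) → Prop := fun s =>
    s.card = 2 * m ∧ 2 * (s.filter fun i => (ofLex i).2 = 0).card = 2 * m with hp
  haveI : Nonempty {s // p s} := nonempty_spinZeroSector (L := L) hm
  exact re_gibbsState_sum_spinDensityField_sq_toBlock_le_attractive_dir hLe hL hU hβ hm p
    (fun s => spinZeroSector_iff_upPart_downPart s m) a ε hε hεmax ha

/-- Node: **Cor. 11.4 — the sharp `q`-dependent CDW ceiling of the repulsive torus in the half-filled
`(L², S^z = 0)` sector, Mott window** (UNCONDITIONAL; the sector and state of #158): for every even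
`L ≥ 4`, `0 ≤ U₁ < U`, `Δ ≠ 0`, `T > 0` and every direction-homogeneous family `a_i` as above:
`Σ_i Re⟨(N_{a_i}|_p)²⟩_{β,p} ≤ B T/U + ½ √((B/U) ε_max k_p)`,
`k_p = L² (U₁ sdwClosed U Δ - U lmClosed U₁)/(U - U₁) + (U₁/(U - U₁)) T log N_p`; per site for a plane
wave: `S^{cc}_{β,p}(q) ≤ T/U + |sin(q_max/2)| √(κ̃_p/U)` with row T9ᶜ's `κ̃_p`. kind: support (PROVED).
Why it might fail: it cannot; informative for `U ≳ 14 t`. Sources: KuboKishi1990 Thm 2 eq. (5),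
Remark 3; LiebPRL1989 Thm 2; DLS1978 Lemma 4.1; KomaTasakiPRL1992 eqs. (5)–(8); this cell (bounds.tex
Prop. 11.5, Cor. 11.4; #179.1, #173, #158). -/
@[conjecture] def ThermalMottCDWCeilingCanonicalDir : Prop :=
  ∀ (L : ℕ) [NeZero L], Even L → 3 ≤ L → ∀ (U U₁ Δ β : ℝ) (ι : Type) [Fintype ι]
    (a : ι → FermionTorus 2 L → ℝ) (ε : Fin 2 → ℝ) (εmax : ℝ), 0 ≤ U₁ → U₁ < U → Δ ≠ 0 → 0 < β →
    (∀ j, ε j ≤ εmax) → 0 ≤ εmax →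
    (∀ u v, (fermionTorusGraph 2 L).Adj u v → ∑ i, (a i u - a i v) ^ 2 = ∑ j, ε j * dirWeight j u v) →
    let p : Finset (Orb (FermionTorus 2 L)) → Prop := fun s =>
      s.card = L ^ 2 ∧ 2 * (s.filter fun i => (ofLex i).2 = 0).card = L ^ 2
    ∑ i, (gibbsState β ((hubbardTorusTT' L 1 0 U).toBlock p p)
        ((chargeDensityField (a i)).toBlock p p * (chargeDensityField (a i)).toBlock p p)).re ≤
      (∑ i, ∑ x, a i x ^ 2) / U / β +
        1 / 2 * Real.sqrt ((∑ i, ∑ x, a i x ^ 2) / U *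
          (εmax * ((L : ℝ) ^ 2 * ((U₁ * sdwClosed U Δ - U * lmClosed U₁) / (U - U₁)) +
            U₁ / (U - U₁) * (Real.log (Fintype.card {s // p s}) / β))))

/-- **`ThermalMottCDWCeilingCanonicalDir` holds.** -/
theorem thermalMottCDWCeilingCanonicalDir_holds : ThermalMottCDWCeilingCanonicalDir := by
  intro L _ hLe hL U U₁ Δ β ι _ a ε εmax hU₁ hU hΔ hβ hε hεmax ha
  dsimp only
  set p : Finset (Orb (FermionTorus 2 L)) → Prop := fun s =>
    s.card = L ^ 2 ∧ 2 * (s.filter fun i => (ofLex i).2 = 0).card = L ^ 2 with hp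
  haveI : Nonempty {s // p s} := nonempty_halfFilledSector (L := L) hLe
  exact re_gibbsState_sum_chargeDensityField_sq_toBlock_le_mott_dir hLe hL hU₁ hU hΔ hβ p
    (fun s => halfFilledSector_iff hLe s) a ε hε hεmax ha

end Torus

end Summit.HubbardSuperconductivity.HubbardLadder.Bounds
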